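import Literature.Topology.FourManifolds.MorseBirthInsertion
import HarnessLib

/-!
# Symmetric insertion of a pair of auxiliary critical points (Milnor 1965, Lemma 8.2 and
# proof of Thm. 8.1, equivariant form)

Topic `Literature/Topology/FourManifolds` (fact seat
`provefact-Literature.IsHandlebody.exists_isBoundaryGluing_sphere`, leaf **SYMM**
`Literature.Topology.FourManifolds.exists_isHandlebody_isOrientationReversing` of `LickorishWallaceHandlebodies.lean`: *some
genus-`g` handlebody has an orientation-reversing symmetry* — Juhász, *Differential and
Low-Dimensional Topology* (2023), §3.5, p. 97: "every handlebody admits an orientation-reversing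
symmetry".  The model handlebody is a sublevel set `{F ≤ c}` of a Morse function on `S³` with
critical points of indices `0, 1, …, 1, 2, …, 2, 3` obtained by repeated insertion of cancelling
pairs (`SphereGenusSplitting.lean`); to make a reflection of `S³` act on it, the insertions have
to be done *symmetrically*.  This file supplies the equivariant form of the insertion step of
`MorseBirthInsertion.lean`.)  Everything here is **proved**.

Milnor, *Lectures on the h-cobordism theorem* (1965), proof of Lemma 8.2 (PDF p. 55): the
function with one cancelling pair of critical points of indices `λ`, `λ + 1` is

> `f = x + s(x) α(y² + z²) + γ(x)(-y² + z²) β(y² + z²)`,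

which depends on the coordinates `y = (y_i)`, `z = (z_i)` only through `y_i²`, `z_i²`; hence it
is invariant under the reflection `u ↦ u - 2 u_j e_j` in every coordinate hyperplane `{u_j = 0}`,
`j ≠ 0` (`Literature.Topology.FourManifolds.MorseBirth.F_coordReflection`).  Consequently:

* `Literature.MorseBirth.coordReflection j` — the reflection of `ℝⁿ⁺¹` in `{u_j = 0}` (Mathlib's
  `Submodule.reflection`), with its coordinates (`coordReflection_apply`);
* `Literature.Topology.FourManifolds.MorseBirth.exists_birthPair_fine_symm` — Lemma 8.2 with support in a prescribed ball
  `B(x₀, r)` and `|f - x₁| < ε` (as `Literature.Topology.FourManifolds.MorseBirth.exists_birthPair_fine`), the function being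
  moreover even in `u_j` for every `j ≠ 0` with `x₀ j = 0` (the tree's function
  `Literature.Topology.FourManifolds.MorseBirth.F` conjugated by homotheties centred at `x₀`);
* `Literature.birthInsert Θ φ f` — the inserted function of the proof of Thm. 8.1 Index 1 (PDF p. 56:
  *"Use Lemma 8.2 to alter `f` on a compact subset of `U`"*): `φ ∘ Θ` on the domain of a chart
  `Θ` in which `f` is the first coordinate, `f` elsewhere; `Literature.Topology.FourManifolds.IsMorse.birthInsert_spec` — its
  properties (Morse, `= f` off a compact subset of the chart domain and near `crit f`,
  `|g - f| < ε`, `crit g = crit f ∪ {q, r}` with indices `k`, `k + 1`, `g q < g r`), i.e. the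
  statement of `Literature.Topology.FourManifolds.IsMorse.exists_insert_birthPair_of_chart` for this explicit function, with
  the same proof; `Literature.Topology.FourManifolds.birthInsert_comp_apply` — its invariance under a self-map `ρ` of `M`
  preserving `f` and the chart domain and conjugated by `Θ` to a symmetry of `φ`;
* `Literature.Topology.FourManifolds.IsMorse.exists_insert_birthPair_of_chart_symm` — **the symmetric insertion step**: if
  `ρ` preserves `f`, maps `Θ.source` onto itself and `Θ ∘ ρ = σ_j ∘ Θ` for the coordinate
  reflection `σ_j`, `j ≠ 0`, with `(Θ z) j = 0`, then the new Morse function with the two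
  auxiliary critical points near `z` can be chosen `ρ`-invariant.

## References

* J. Milnor, *Lectures on the h-cobordism theorem*, notes by L. Siebenmann and J. Sondow,
  Princeton Mathematical Notes (1965): Lemma 8.2 and its proof (PDF pp. 54–55), proof of
  Thm. 8.1 for Index 1 (PDF p. 56).  Held: `lit read book:milnornd-lectures-h-cobordism-theorem`.
  [MilnorHCobordism1965]
* A. Juhász, *Differential and Low-Dimensional Topology*, LMS Student Texts 104 (2023), §3.5,
  p. 97. [Juhasz2023]
-/

open scoped Manifold ContDiff Topology RealInnerProductSpace
open Set Function Filter Metric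

noncomputable section

namespace Literature.Topology.FourManifolds

/-- Local notation: `𝔼 n` is the model Euclidean space `EuclideanSpace ℝ (Fin n)`. -/
local notation "𝔼 " n:arg => EuclideanSpace ℝ (Fin n)

namespace MorseBirth

variable {n : ℕ}

/-! ### Coordinate reflections of the model space -/

/-- The **reflection of `ℝⁿ⁺¹` in the coordinate hyperplane `{u | u j = 0}`**, `u ↦ u - 2 uⱼ eⱼ`
(Mathlib's `Submodule.reflection` in the orthogonal complement of the `j`-th standard basis
vector), a linear isometry. [folklore] -/
def coordReflection (j : Fin (n + 1)) : 𝔼 (n + 1) ≃ₗᵢ[ℝ] 𝔼 (n + 1) :=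
  (ℝ ∙ EuclideanSpace.single j (1 : ℝ))ᗮ.reflection

/-- The coordinate reflection as a vector: `u - 2 uⱼ eⱼ`. [folklore] -/
theorem coordReflection_eq (j : Fin (n + 1)) (u : 𝔼 (n + 1)) :
    coordReflection j u = u - (2 * u j) • EuclideanSpace.single j (1 : ℝ) := by
  unfold coordReflection
  rw [Submodule.reflection_orthogonal_apply, Submodule.reflection_singleton_apply,
    EuclideanSpace.inner_single_left]
  simp only [map_one, one_mul, PiLp.norm_single, norm_one, one_pow, div_one, neg_sub]
  rw [← Nat.cast_smul_eq_nsmul ℝ (2 : ℕ), smul_smul, Nat.cast_ofNat]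

/-- The coordinates of the reflected vector: the `j`-th one changes sign. [folklore] -/
@[simp]
theorem coordReflection_apply (j : Fin (n + 1)) (u : 𝔼 (n + 1)) (i : Fin (n + 1)) :
    coordReflection j u i = if i = j then -u i else u i := by
  rw [coordReflection_eq]
  simp only [PiLp.sub_apply, PiLp.smul_apply, PiLp.single_apply, smul_eq_mul]
  split_ifs with h
  · subst h; ring
  · ring

/-- A coordinate reflection is an involution. [folklore] -/
@[simp]
theorem coordReflection_coordReflection (j : Fin (n + 1)) (u : 𝔼 (n + 1)) :
    coordReflection j (coordReflection j u) = u :=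
  Submodule.reflection_reflection _ u

/-- A vector is fixed by the `j`-th coordinate reflection iff its `j`-th coordinate vanishes.
[folklore] -/
theorem coordReflection_eq_self_iff (j : Fin (n + 1)) (u : 𝔼 (n + 1)) :
    coordReflection j u = u ↔ u j = 0 := by
  constructor
  · intro h
    have := congrArg (fun v : 𝔼 (n + 1) => v j) h
    simp only [coordReflection_apply, if_true] at this
    linarith
  · intro h
    ext i
    rw [coordReflection_apply]
    split_ifs with hi
    · subst hi; rw [h, neg_zero]
    · rfl

/-- The squares of the coordinates are unchanged by a coordinate reflection. [folklore] -/
theorem coordReflection_apply_sq (j : Fin (n + 1)) (u : 𝔼 (n + 1)) (i : Fin (n + 1)) :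
    coordReflection j u i ^ 2 = u i ^ 2 := by
  rw [coordReflection_apply]
  split_ifs <;> ring

/-- A weighted sum of squares of coordinates is invariant under coordinate reflections. [folklore] -/
theorem wsq_coordReflection (a : Fin (n + 1) → ℝ) (j : Fin (n + 1)) (u : 𝔼 (n + 1)) :
    wsq a (coordReflection j u) = wsq a u := by
  simp only [wsq, coordReflection_apply_sq]

/-- The first coordinate is invariant under the reflections in the other coordinates. [folklore] -/
theorem xc_coordReflection {j : Fin (n + 1)} (hj : j ≠ 0) (u : 𝔼 (n + 1)) :
    xc (coordReflection j u) = xc u := by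
  simp [xc, coordReflection_apply, hj.symm]

/-- **Milnor's function `f = x + s(x) α(y² + z²) + γ(x)(-y² + z²) β(y² + z²)` is even in each of
the coordinates `y_i`, `z_i`**: it depends on them only through their squares, so it is
invariant under the reflection in any coordinate hyperplane `{u_j = 0}`, `j ≠ 0`.
[cite: MilnorHCobordism1965, proof of Lemma 8.2 (PDF p. 55), the formula for `f`] -/
theorem F_coordReflection (k : ℕ) (R R' : ℝ) {j : Fin (n + 1)} (hj : j ≠ 0) (u : 𝔼 (n + 1)) :
    F k R R' (coordReflection j u) = F k R R' u := by
  simp only [F, qq, QQ, wsq_coordReflection, xc_coordReflection hj]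

/-- The affine contraction about a centre fixed by a linear map `σ` commutes with `σ`. [folklore] -/
theorem contract_coordReflection {x₀ : 𝔼 (n + 1)} {s : ℝ} {j : Fin (n + 1)}
    (hx₀ : coordReflection j x₀ = x₀) (u : 𝔼 (n + 1)) :
    contract x₀ s (coordReflection j u) = coordReflection j (contract x₀ s u) := by
  simp only [contract, map_smul, map_sub, hx₀]

/-- Rescaling about a centre on the hyperplane `{u_j = 0}` preserves evenness in `u_j`. [folklore] -/
theorem rescale_coordReflection {x₀ : 𝔼 (n + 1)} {s : ℝ} {f : 𝔼 (n + 1) → ℝ} {j : Fin (n + 1)}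
    (hx₀ : x₀ j = 0) (hf : ∀ u, f (coordReflection j u) = f u) (u : 𝔼 (n + 1)) :
    rescale x₀ s f (coordReflection j u) = rescale x₀ s f u := by
  simp only [rescale, contract_coordReflection ((coordReflection_eq_self_iff j x₀).2 hx₀), hf]

/-! ### Lemma 8.2 with small support, symmetric version -/

/-- **Milnor's Lemma 8.2 with small support and small `C⁰`-deviation, symmetric version.**  As
`Literature.Topology.FourManifolds.MorseBirth.exists_birthPair_fine` (for `0 ≤ k < n + 1`, a centre `x₀`, a radius `r > 0` and
`ε > 0`: a Morse function on `ℝⁿ⁺¹` equal to `x₁` off a compact subset of `B(x₀, r)`, `ε`-close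
to `x₁`, with exactly two critical points `p₁ ≠ p₂` of indices `k`, `k + 1` and `f(p₁) < f(p₂)`),
and moreover *even in each coordinate `u_j`, `j ≠ 0`, whose hyperplane `{u_j = 0}` passes
through the centre* (`x₀ j = 0`): the function is Milnor's
`x + s(x) α(y² + z²) + γ(x)(-y² + z²) β(y² + z²)` (`Literature.Topology.FourManifolds.MorseBirth.F`, which depends on `y`, `z`
only through `y_i²`, `z_i²`) conjugated by homotheties centred at `x₀`.
[cite: MilnorHCobordism1965, Lemma 8.2 and its proof (PDF pp. 54–55)] -/
theorem exists_birthPair_fine_symm (n k : ℕ) (hk : k < n + 1) (x₀ : 𝔼 (n + 1)) {r ε : ℝ}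
    (hr : 0 < r) (hε : 0 < ε) :
    ∃ f : 𝔼 (n + 1) → ℝ, IsMorse (𝓡 (n + 1)) f ∧
      (∃ K : Set (𝔼 (n + 1)), IsCompact K ∧ K ⊆ ball x₀ r ∧ ∀ u ∉ K, f u = u 0) ∧
      (∀ u, |f u - u 0| < ε) ∧
      (∃ p₁ p₂ : 𝔼 (n + 1), p₁ ≠ p₂ ∧ criticalSet (𝓡 (n + 1)) f = {p₁, p₂} ∧
        morseIndex (𝓡 (n + 1)) f p₁ = k ∧ morseIndex (𝓡 (n + 1)) f p₂ = k + 1 ∧ f p₁ < f p₂) ∧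
      ∀ j : Fin (n + 1), j ≠ 0 → x₀ j = 0 → ∀ u, f (coordReflection j u) = f u := by
  obtain ⟨C, S, R₁, R', hA⟩ := exists_admissible
  obtain ⟨hf, ⟨K, hK, hfK⟩, p₁, p₂, hne, hcrit, hi₁, hi₂, hlt⟩ := hA.birthPair (n := n) hk
  set f : 𝔼 (n + 1) → ℝ := F k R₁ R' with hfdef
  have hfc : ContDiff ℝ ∞ f := contMDiff_iff_contDiff.1 hf.1
  -- a radius for `K` and a bound for `f - x₁`
  obtain ⟨R₀, hR₀⟩ := hK.isBounded.subset_closedBall 0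
  set R : ℝ := max R₀ 1 with hR
  have hRpos : 0 < R := lt_of_lt_of_le one_pos (le_max_right _ _)
  have hKR : K ⊆ closedBall 0 R := hR₀.trans (closedBall_subset_closedBall (le_max_left _ _))
  have hcont : Continuous fun u => f u - u 0 :=
    hfc.continuous.sub (EuclideanSpace.proj (0 : Fin (n + 1))).continuous
  obtain ⟨B₀, hB₀⟩ := hK.exists_bound_of_continuousOn hcont.continuousOn
  set B : ℝ := max B₀ 1 with hB
  have hBpos : 0 < B := lt_of_lt_of_le one_pos (le_max_right _ _)
  have hbound : ∀ u, |f u - u 0| ≤ B := by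
    intro u
    by_cases hu : u ∈ K
    · exact ((Real.norm_eq_abs _).symm.le.trans (hB₀ u hu)).trans (le_max_left _ _)
    · rw [hfK u hu, sub_self, abs_zero]; exact hBpos.le
  -- the scale
  set s : ℝ := min (r / (2 * R)) (ε / (2 * B)) with hs
  have hspos : 0 < s := lt_min (by positivity) (by positivity)
  have hsR : s * R < r := by
    have : s ≤ r / (2 * R) := min_le_left _ _
    calc s * R ≤ r / (2 * R) * R := by gcongr
      _ = r / 2 := by field_simp
      _ < r := by linarith
  have hsB : s * B < ε := by
    have : s ≤ ε / (2 * B) := min_le_right _ _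
    calc s * B ≤ ε / (2 * B) * B := by gcongr
      _ = ε / 2 := by field_simp
      _ < ε := by linarith
  refine ⟨rescale x₀ s f, isMorse_rescale hspos hf, ⟨(fun v => x₀ + s • v) '' K,
    hK.image (by fun_prop), ?_, fun u hu => rescale_eq_of_not_mem hspos.ne' hfK hu⟩, fun u => ?_,
    ⟨x₀ + s • p₁, x₀ + s • p₂, fun h => hne ?_, ?_, ?_, ?_, ?_⟩, fun j hj hx₀ u => ?_⟩
  · rintro _ ⟨v, hv, rfl⟩
    rw [mem_ball, dist_eq_norm, add_sub_cancel_left, norm_smul, Real.norm_eq_abs, abs_of_pos hspos]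
    have : ‖v‖ ≤ R := by simpa using hKR hv
    calc s * ‖v‖ ≤ s * R := by gcongr
      _ < r := hsR
  · rw [rescale_sub_apply_zero hspos.ne', abs_mul, abs_of_pos hspos]
    calc s * |f (contract x₀ s u) - contract x₀ s u 0| ≤ s * B := by gcongr; exact hbound _
      _ < ε := hsB
  · have := congrArg (contract x₀ s) h
    rwa [contract_expand hspos.ne', contract_expand hspos.ne'] at this
  · rw [criticalSet_rescale hspos.ne' (hfc.differentiable (by simp)), hcrit, image_pair]
  · rw [morseIndex_rescale hspos (hfc.of_le (by norm_cast)), contract_expand hspos.ne', hi₁]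
  · rw [morseIndex_rescale hspos (hfc.of_le (by norm_cast)), contract_expand hspos.ne', hi₂]
  · simp only [rescale, contract_expand hspos.ne']
    gcongr
  · exact rescale_coordReflection hx₀ (fun u => F_coordReflection k R₁ R' hj u) u

end MorseBirth

/-! ### The inserted function, for a given birth function in a given chart -/

section Insert

variable {n : ℕ} {H : Type*} [TopologicalSpace H] {I : ModelWithCorners ℝ (𝔼 (n + 1)) H}
  {M : Type*} [TopologicalSpace M] [ChartedSpace H M]

open Classical in
/-- **The inserted function** of Milnor's construction (proof of Thm. 8.1 Index 1, PDF p. 56: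
*"Use Lemma 8.2 to alter `f` on a compact subset of `U`"*): `φ ∘ Θ` on the chart domain
`Θ.source` and `f` elsewhere, for a local diffeomorphism `Θ` of `M` into `ℝⁿ⁺¹` in which `f` is
the first coordinate and a function `φ` on `ℝⁿ⁺¹` equal to the first coordinate off a compact
subset of `Θ.target` (the function hidden in the proof of
`Literature.Topology.FourManifolds.IsMorse.exists_insert_birthPair_of_chart`, exposed so that its symmetries can be read off).
[cite: MilnorHCobordism1965, proof of Thm. 8.1 Index 1 (PDF p. 56)] -/
def birthInsert (Θ : OpenPartialHomeomorph M (𝔼 (n + 1))) (φ : 𝔼 (n + 1) → ℝ) (f : M → ℝ) :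
    M → ℝ :=
  Θ.source.piecewise (φ ∘ Θ) f

omit [TopologicalSpace H] [ChartedSpace H M] in
/-- On the chart domain the inserted function is `φ ∘ Θ`. [folklore] -/
theorem birthInsert_of_mem {Θ : OpenPartialHomeomorph M (𝔼 (n + 1))} {φ : 𝔼 (n + 1) → ℝ}
    {f : M → ℝ} {x : M} (hx : x ∈ Θ.source) : birthInsert Θ φ f x = φ (Θ x) := by
  classical
  exact Θ.source.piecewise_eq_of_mem _ _ hx

omit [TopologicalSpace H] [ChartedSpace H M] in
/-- Off the chart domain the inserted function is `f`. [folklore] -/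
theorem birthInsert_of_not_mem {Θ : OpenPartialHomeomorph M (𝔼 (n + 1))} {φ : 𝔼 (n + 1) → ℝ}
    {f : M → ℝ} {x : M} (hx : x ∉ Θ.source) : birthInsert Θ φ f x = f x := by
  classical
  exact Θ.source.piecewise_eq_of_notMem _ _ hx

omit [TopologicalSpace H] [ChartedSpace H M] in
/-- **Symmetry of the inserted function.**  If a self-map `ρ` of `M` preserves `f` and the chart
domain, and is conjugated by the chart `Θ` to a self-map `σ` of `ℝⁿ⁺¹` preserving `φ`, then the
inserted function is `ρ`-invariant. [folklore] -/
theorem birthInsert_comp_apply {Θ : OpenPartialHomeomorph M (𝔼 (n + 1))} {φ : 𝔼 (n + 1) → ℝ}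
    {f : M → ℝ} {ρ : M → M} {σ : 𝔼 (n + 1) → 𝔼 (n + 1)}
    (hρs : ∀ x, ρ x ∈ Θ.source ↔ x ∈ Θ.source) (hρΘ : ∀ x ∈ Θ.source, Θ (ρ x) = σ (Θ x))
    (hσφ : ∀ u, φ (σ u) = φ u) (hρf : ∀ x, f (ρ x) = f x) (x : M) :
    birthInsert Θ φ f (ρ x) = birthInsert Θ φ f x := by
  by_cases hx : x ∈ Θ.source
  · rw [birthInsert_of_mem hx, birthInsert_of_mem ((hρs x).2 hx), hρΘ x hx, hσφ]
  · rw [birthInsert_of_not_mem hx, birthInsert_of_not_mem (fun h => hx ((hρs x).1 h)), hρf]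

/-- **Inserting a pair of auxiliary critical points, in a chart straightening `f`, with a given
birth function** — the content of `Literature.Topology.FourManifolds.IsMorse.exists_insert_birthPair_of_chart` (Milnor 1965,
proof of Thm. 8.1 Index 1 via Lemma 8.2) for the *explicit* function `Literature.birthInsert Θ φ f`.
Let `f` be a Morse function on `M`, `Θ` a local diffeomorphism of `M` into `ℝⁿ⁺¹` (smooth with
smooth inverse) with source in the interior and `(Θ x) 0 = f x`, and `φ` a Morse function on
`ℝⁿ⁺¹` equal to `u 0` off a compact set `K ⊆ Θ.target`, everywhere `ε`-close to `u 0`, with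
critical set `{p₁, p₂}`, `p₁ ≠ p₂`, of indices `k`, `k + 1` and `φ p₁ < φ p₂` (as produced by
`Literature.Topology.FourManifolds.MorseBirth.exists_birthPair_fine`).  Then `g = birthInsert Θ φ f` is a Morse function equal
to `f` off the compact set `Θ⁻¹(K) ⊆ Θ.source` and near the critical points of `f`, `ε`-close
to `f`, with `crit g = crit f ∪ {q, r}`, `q = Θ⁻¹ p₁ ≠ r = Θ⁻¹ p₂` new points of `Θ.source` of
indices `k`, `k + 1`, `g q < g r`, the old indices unchanged.  The proof is that of
`exists_insert_birthPair_of_chart`, verbatim.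
[cite: MilnorHCobordism1965, proof of Thm. 8.1 Index 1 (PDF p. 56), with Lemma 8.2 (PDF pp. 54–55)] -/
theorem IsMorse.birthInsert_spec [IsManifold I ∞ M] [T2Space M] {f : M → ℝ}
    (hf : IsMorse I f) {Θ : OpenPartialHomeomorph M (𝔼 (n + 1))}
    (hΘ : ContMDiffOn I 𝓘(ℝ, 𝔼 (n + 1)) ∞ Θ Θ.source)
    (hΘ' : ContMDiffOn 𝓘(ℝ, 𝔼 (n + 1)) I ∞ Θ.symm Θ.target)
    (hint : ∀ x ∈ Θ.source, I.IsInteriorPoint x) (hΘf : ∀ x ∈ Θ.source, Θ x 0 = f x)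
    {φ : 𝔼 (n + 1) → ℝ} (hφM : IsMorse (𝓡 (n + 1)) φ) {K : Set (𝔼 (n + 1))} (hK : IsCompact K)
    (hKt : K ⊆ Θ.target) (hφK : ∀ u ∉ K, φ u = u 0) {ε : ℝ} (hε : 0 < ε)
    (hφε : ∀ u, |φ u - u 0| < ε) {p₁ p₂ : 𝔼 (n + 1)} (hne : p₁ ≠ p₂)
    (hcritφ : criticalSet (𝓡 (n + 1)) φ = {p₁, p₂}) {k : ℕ}
    (hi₁ : morseIndex (𝓡 (n + 1)) φ p₁ = k) (hi₂ : morseIndex (𝓡 (n + 1)) φ p₂ = k + 1)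
    (hlt : φ p₁ < φ p₂) :
    IsMorse I (birthInsert Θ φ f) ∧
      (∀ x ∉ Θ.symm '' K, birthInsert Θ φ f x = f x) ∧
      (∀ x, |birthInsert Θ φ f x - f x| < ε) ∧
      (∀ x ∈ criticalSet I f, birthInsert Θ φ f =ᶠ[𝓝 x] f) ∧
      (∀ x ∈ criticalSet I f, morseIndex I (birthInsert Θ φ f) x = morseIndex I f x) ∧
      Θ.symm p₁ ∈ Θ.source ∧ Θ.symm p₂ ∈ Θ.source ∧ Θ.symm p₁ ≠ Θ.symm p₂ ∧
      Θ.symm p₁ ∉ criticalSet I f ∧ Θ.symm p₂ ∉ criticalSet I f ∧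
      criticalSet I (birthInsert Θ φ f) =
        insert (Θ.symm p₁) (insert (Θ.symm p₂) (criticalSet I f)) ∧
      morseIndex I (birthInsert Θ φ f) (Θ.symm p₁) = k ∧
      morseIndex I (birthInsert Θ φ f) (Θ.symm p₂) = k + 1 ∧
      birthInsert Θ φ f (Θ.symm p₁) < birthInsert Θ φ f (Θ.symm p₂) := by
  have hfs : ContMDiff I 𝓘(ℝ, ℝ) ∞ f := hf.1
  have hφs : ContDiff ℝ ∞ φ := contMDiff_iff_contDiff.1 hφM.1
  -- `φ = x₁` near every point off `K`; the critical points of `φ` lie in `K`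
  have hφev : ∀ u ∉ K, φ =ᶠ[𝓝 u] fun w => w 0 := fun u hu =>
    mem_of_superset (hK.isClosed.isOpen_compl.mem_nhds hu) fun w hw => hφK w hw
  have hpK : ∀ p ∈ criticalSet (𝓡 (n + 1)) φ, p ∈ K := by
    intro p hp
    by_contra hpK
    exact fderiv_ne_zero_of_eventuallyEq_apply_zero (hφev p hpK)
      ((MorseBirth.isMCriticalPt_iff_fderiv φ p).1 hp)
  have hp₁K : p₁ ∈ K := hpK p₁ (by rw [hcritφ]; exact mem_insert _ _)
  have hp₂K : p₂ ∈ K := hpK p₂ (by rw [hcritφ]; exact mem_insert_of_mem _ rfl)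
  -- the transplanted support
  set KM : Set M := Θ.symm '' K with hKM
  have hKMc : IsCompact KM := hK.image_of_continuousOn (Θ.continuousOn_symm.mono hKt)
  have hKMs : KM ⊆ Θ.source := by
    rintro _ ⟨u, hu, rfl⟩; exact Θ.map_target (hKt hu)
  have hKMclosed : IsClosed KM := hKMc.isClosed
  -- the new function
  set g : M → ℝ := birthInsert Θ φ f with hg
  have hgs : ∀ x ∈ Θ.source, g x = φ (Θ x) := fun x hx => birthInsert_of_mem hx
  have hgf : ∀ x ∉ KM, g x = f x := by
    intro x hx
    by_cases hxs : x ∈ Θ.source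
    · have hxK : Θ x ∉ K := fun h => hx ⟨Θ x, h, Θ.left_inv hxs⟩
      rw [hgs x hxs, hφK _ hxK, hΘf x hxs]
    · exact birthInsert_of_not_mem hxs
  have hgt : ∀ w ∈ Θ.target, g (Θ.symm w) = φ w := fun w hw => by
    rw [hgs _ (Θ.map_target hw), Θ.right_inv hw]
  have hgf_ev : ∀ x ∉ KM, g =ᶠ[𝓝 x] f := fun x hx =>
    mem_of_superset (hKMclosed.isOpen_compl.mem_nhds hx) fun y hy => hgf y hy
  have hgs_ev : ∀ x ∈ Θ.source, g =ᶠ[𝓝 x] φ ∘ Θ := fun x hx =>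
    mem_of_superset (Θ.open_source.mem_nhds hx) fun y hy => hgs y hy
  have hgt_ev : ∀ w ∈ Θ.target, g ∘ Θ.symm =ᶠ[𝓝 w] φ := fun w hw =>
    mem_of_superset (Θ.open_target.mem_nhds hw) fun v hv => hgt v hv
  have hft_ev : ∀ w ∈ Θ.target, f ∘ Θ.symm =ᶠ[𝓝 w] fun v => v 0 := fun w hw =>
    mem_of_superset (Θ.open_target.mem_nhds hw) fun v hv => by
      show f (Θ.symm v) = v 0
      rw [← hΘf _ (Θ.map_target hv), Θ.right_inv hv]
  -- smoothness
  have hΘat : ∀ x ∈ Θ.source, ContMDiffAt I 𝓘(ℝ, 𝔼 (n + 1)) ∞ Θ x := fun x hx =>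
    (hΘ x hx).contMDiffAt (Θ.open_source.mem_nhds hx)
  have hgsmooth : ContMDiff I 𝓘(ℝ, ℝ) ∞ g := by
    intro x
    by_cases hxs : x ∈ Θ.source
    · exact ((contMDiff_iff_contDiff.2 hφs).contMDiffAt.comp x (hΘat x hxs)).congr_of_eventuallyEq
        (hgs_ev x hxs)
    · exact (hfs x).congr_of_eventuallyEq (hgf_ev x fun h => hxs (hKMs h))
  have hgmd : ∀ x, MDifferentiableAt I 𝓘(ℝ, ℝ) g x := fun x => hgsmooth.mdifferentiableAt (by simp)
  -- no critical point of `f` in the chart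
  have hfreg : ∀ x ∈ Θ.source, ¬ IsMCriticalPt I f x := by
    intro x hx hcrit
    have h1 := (isMCriticalPt_iff_fderiv_comp_symm_eq_zero hΘ hΘ' hx
      (hfs.mdifferentiableAt (by simp))).1 hcrit
    exact fderiv_ne_zero_of_eventuallyEq_apply_zero (hft_ev _ (Θ.map_source hx)) h1
  -- the critical points of `g` in the chart
  set q : M := Θ.symm p₁ with hq
  set r : M := Θ.symm p₂ with hr
  have hqs : q ∈ Θ.source := Θ.map_target (hKt hp₁K)
  have hrs : r ∈ Θ.source := Θ.map_target (hKt hp₂K)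
  have hΘq : Θ q = p₁ := Θ.right_inv (hKt hp₁K)
  have hΘr : Θ r = p₂ := Θ.right_inv (hKt hp₂K)
  have hqr : q ≠ r := fun h => hne (by rw [← hΘq, ← hΘr, h])
  have hcrit_in : ∀ x ∈ Θ.source, (IsMCriticalPt I g x ↔ x = q ∨ x = r) := by
    intro x hx
    rw [isMCriticalPt_iff_fderiv_comp_symm_eq_zero hΘ hΘ' hx (hgmd x),
      (hgt_ev _ (Θ.map_source hx)).fderiv_eq, ← MorseBirth.isMCriticalPt_iff_fderiv,
      ← mem_criticalSet, hcritφ]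
    constructor
    · rintro (h | h)
      · left; rw [hq, ← h, Θ.left_inv hx]
      · right; rw [hr, ← h, Θ.left_inv hx]
    · rintro (rfl | rfl)
      · exact Or.inl hΘq
      · exact Or.inr hΘr
  have hcrit_out : ∀ x ∉ KM, (IsMCriticalPt I g x ↔ IsMCriticalPt I f x) := fun x hx =>
    isMCriticalPt_congr_of_eventuallyEq_add_const (I := I) (c := 0)
      ((hgf_ev x hx).trans (Eventually.of_forall fun y => (add_zero (f y)).symm))
  have hhess_out : ∀ x ∉ KM, mhessian I g x = mhessian I f x := fun x hx =>
    mhessian_congr_of_eventuallyEq_add_const (I := I) (c := 0)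
      ((hgf_ev x hx).trans (Eventually.of_forall fun y => (add_zero (f y)).symm))
  -- the critical set
  have hcritg : criticalSet I g = insert q (insert r (criticalSet I f)) := by
    ext x
    simp only [mem_criticalSet, mem_insert_iff]
    by_cases hxs : x ∈ Θ.source
    · rw [hcrit_in x hxs]
      have := hfreg x hxs
      tauto
    · have hxK : x ∉ KM := fun h => hxs (hKMs h)
      rw [hcrit_out x hxK]
      have h1 : x ≠ q := fun h => hxs (h ▸ hqs)
      have h2 : x ≠ r := fun h => hxs (h ▸ hrs)
      tauto
  -- Hessians at the new critical points, read in `Θ`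
  have hhess_in : ∀ x ∈ Θ.source, IsMCriticalPt I g x →
      ((mhessian I g x).Nondegenerate ↔ (mhessian (𝓡 (n + 1)) φ (Θ x)).Nondegenerate) ∧
      morseIndex I g x = morseIndex (𝓡 (n + 1)) φ (Θ x) := by
    intro x hx hcrit
    obtain ⟨L, hL⟩ := exists_mhessian_apply_eq_fderiv_fderiv_comp_symm hΘ hΘ' hgsmooth hx
      (hint x hx) hcrit
    have h2 : fderiv ℝ (fderiv ℝ (g ∘ Θ.symm)) (Θ x) = fderiv ℝ (fderiv ℝ φ) (Θ x) :=
      (hgt_ev _ (Θ.map_source hx)).fderiv.fderiv_eq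
    have key : ∀ v w, mhessian I g x v w = mhessian (𝓡 (n + 1)) φ (Θ x) (L v) (L w) := by
      intro v w
      rw [hL, h2, MorseBirth.mhessian_model_apply]
    exact ⟨nondegenerate_iff_of_forall_apply_eq (L : 𝔼 (n + 1) ≃L[ℝ] 𝔼 (n + 1)).toLinearEquiv key,
      sigNeg_eq_of_forall_apply_eq (L : 𝔼 (n + 1) ≃L[ℝ] 𝔼 (n + 1)).toLinearEquiv key⟩
  -- `g` is a Morse function
  have hgM : IsMorse I g := by
    refine ⟨hgsmooth, fun x hx => ?_⟩
    by_cases hxs : x ∈ Θ.source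
    · refine (hhess_in x hxs hx).1.2 (hφM.2 _ ?_)
      rcases (hcrit_in x hxs).1 hx with rfl | rfl
      · rw [hΘq]; exact (show p₁ ∈ criticalSet (𝓡 (n + 1)) φ by rw [hcritφ]; simp)
      · rw [hΘr]; exact (show p₂ ∈ criticalSet (𝓡 (n + 1)) φ by rw [hcritφ]; simp)
    · have hxK : x ∉ KM := fun h => hxs (hKMs h)
      show (mhessian I g x).Nondegenerate
      rw [hhess_out x hxK]
      exact hf.2 x ((hcrit_out x hxK).1 hx)
  -- old critical points lie off `KM`
  have hold : ∀ x ∈ criticalSet I f, x ∉ KM := fun x hx h => hfreg x (hKMs h) hx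
  refine ⟨hgM, hgf, fun x => ?_, fun x hx => hgf_ev x (hold x hx), fun x hx => ?_, hqs, hrs, hqr,
    fun h => hfreg q hqs h, fun h => hfreg r hrs h, hcritg, ?_, ?_, ?_⟩
  · by_cases hxs : x ∈ Θ.source
    · rw [hgs x hxs, ← hΘf x hxs]; exact hφε _
    · rw [hgf x fun h => hxs (hKMs h), sub_self, abs_zero]; exact hε
  · unfold morseIndex; rw [hhess_out x (hold x hx)]
  · rw [(hhess_in q hqs ((hcrit_in q hqs).2 (Or.inl rfl))).2, hΘq, hi₁]
  · rw [(hhess_in r hrs ((hcrit_in r hrs).2 (Or.inr rfl))).2, hΘr, hi₂]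
  · rw [hgs q hqs, hgs r hrs, hΘq, hΘr]; exact hlt

/-- **Symmetric insertion of a pair of auxiliary critical points, in an equivariant chart.**  In
the situation of `Literature.Topology.FourManifolds.IsMorse.exists_insert_birthPair_of_chart` (Milnor 1965, proof of Thm. 8.1
Index 1 via Lemma 8.2) suppose moreover that a self-map `ρ` of `M` preserves `f`, maps the chart
domain onto itself, and is conjugated by the chart `Θ` to the reflection `σ_j` of `ℝⁿ⁺¹` in a
coordinate hyperplane `{u_j = 0}`, `j ≠ 0`, passing through `Θ z`.  Then the new Morse function
`g` (same conclusions: `g = f` off a compact subset of `Θ.source` and near `crit f`, `|g - f| < ε`,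
`crit g = crit f ∪ {q, r}` with new points `q ≠ r` of indices `k`, `k + 1`, `g q < g r`) can be
taken `ρ`-invariant: Milnor's birth function is even in the coordinates `u_j`, `j ≠ 0`
(`Literature.Topology.FourManifolds.MorseBirth.exists_birthPair_fine_symm`), so `g = birthInsert Θ φ f` is `ρ`-invariant
(`Literature.Topology.FourManifolds.birthInsert_comp_apply`).
[cite: MilnorHCobordism1965, proof of Thm. 8.1 Index 1 (PDF p. 56), with Lemma 8.2 (PDF pp. 54–55)] -/
theorem IsMorse.exists_insert_birthPair_of_chart_symm [IsManifold I ∞ M] [T2Space M] {f : M → ℝ}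
    (hf : IsMorse I f) {Θ : OpenPartialHomeomorph M (𝔼 (n + 1))}
    (hΘ : ContMDiffOn I 𝓘(ℝ, 𝔼 (n + 1)) ∞ Θ Θ.source)
    (hΘ' : ContMDiffOn 𝓘(ℝ, 𝔼 (n + 1)) I ∞ Θ.symm Θ.target)
    (hint : ∀ x ∈ Θ.source, I.IsInteriorPoint x) (hΘf : ∀ x ∈ Θ.source, Θ x 0 = f x)
    {z : M} (hz : z ∈ Θ.source) {k : ℕ} (hk : k < n + 1) {ε : ℝ} (hε : 0 < ε)
    {ρ : M → M} {j : Fin (n + 1)} (hj : j ≠ 0) (hρs : ∀ x, ρ x ∈ Θ.source ↔ x ∈ Θ.source)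
    (hρΘ : ∀ x ∈ Θ.source, Θ (ρ x) = MorseBirth.coordReflection j (Θ x))
    (hρf : ∀ x, f (ρ x) = f x) (hzj : Θ z j = 0) :
    ∃ g : M → ℝ, IsMorse I g ∧
      (∃ K : Set M, IsCompact K ∧ K ⊆ Θ.source ∧ ∀ x ∉ K, g x = f x) ∧
      (∀ x, |g x - f x| < ε) ∧
      (∀ x ∈ criticalSet I f, g =ᶠ[𝓝 x] f) ∧
      (∀ x ∈ criticalSet I f, morseIndex I g x = morseIndex I f x) ∧
      (∀ x, g (ρ x) = g x) ∧
      ∃ q r : M, q ∈ Θ.source ∧ r ∈ Θ.source ∧ q ≠ r ∧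
        q ∉ criticalSet I f ∧ r ∉ criticalSet I f ∧
        criticalSet I g = insert q (insert r (criticalSet I f)) ∧
        morseIndex I g q = k ∧ morseIndex I g r = k + 1 ∧ g q < g r := by
  -- a closed ball about `Θ z` inside the target
  obtain ⟨δ, hδ, hδt⟩ : ∃ δ > 0, closedBall (Θ z) δ ⊆ Θ.target :=
    nhds_basis_closedBall.mem_iff.1 (Θ.open_target.mem_nhds (Θ.map_source hz))
  -- the symmetric birth function in that ball
  obtain ⟨φ, hφM, ⟨K, hK, hKball, hφK⟩, hφε, ⟨p₁, p₂, hne, hcritφ, hi₁, hi₂, hlt⟩, hφσ⟩ :=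
    MorseBirth.exists_birthPair_fine_symm n k hk (Θ z) hδ hε
  have hKt : K ⊆ Θ.target := hKball.trans (ball_subset_closedBall.trans hδt)
  obtain ⟨hgM, hgf, hgε, hev, hidx, hqs, hrs, hqr, hq, hr, hcrit, hiq, hir, hglt⟩ :=
    hf.birthInsert_spec hΘ hΘ' hint hΘf hφM hK hKt hφK hε hφε hne hcritφ hi₁ hi₂ hlt
  refine ⟨birthInsert Θ φ f, hgM, ⟨Θ.symm '' K, hK.image_of_continuousOn
    (Θ.continuousOn_symm.mono hKt), ?_, hgf⟩, hgε, hev, hidx,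
    birthInsert_comp_apply hρs hρΘ (hφσ j hj hzj) hρf, Θ.symm p₁, Θ.symm p₂, hqs, hrs, hqr, hq, hr,
    hcrit, hiq, hir, hglt⟩
  rintro _ ⟨u, hu, rfl⟩
  exact Θ.map_target (hKt hu)

end Insert

end Literature.Topology.FourManifolds
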